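import Literature.AlgebraicGeometry.HodgeTheory.NodalPencilShellFields
import HarnessLib

/-!
# Lifted vector fields on `𝒴°(ℂ)` tangent to the chart shells of a monomial pencil near an isolated singular point of
# Pham–Brieskorn type (arbitrary weights): the shell submersion as an abstract hypothesis

Family `hodge`, layer `Literature/AlgebraicGeometry/HodgeTheory`; theorems only (no definition, no named fact). Written by the
prover seat `hodge-nonav-20241-p1` (g19, cell `hodge-nonav`) as the first brick of the port B4c of the programme «A₃-TRACE»
(memo `HOME/memos/PROGRAMME-A3-TRACE-Bx-g16.md` §3; binder hN `stub_a3NonComm` of crux K1-B `VeryGeneralSignCommutatorsInHg`,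
`Summits/HodgeConjecture/HodgeConjecture/Theses/SignSymmetricPowers.lean`, stmt-HodgeConjecture-19716): the WEIGHTED generalisation
of prover-Bx's `NodalPencilJointSubmersion` §2 and `NodalPencilShellFields` (ordinary double point, all Morse weights `2`).

Setting: the regular locus `𝒴°(ℂ)` of the universal family of degree-`d` hypersurfaces in `n + 2` variables, the chart `xᵢ ≠ 0`,
the monomial pencil direction `xᵢ^d`, remaining coefficients `b'` prescribed; `φ(y)` = the solved coefficient of `xᵢ^d` at `(b', y)`
minus the critical value `c₀`; `Θ` a `C^∞` open partial homeomorphism of `ℂⁿ⁺¹` (in the applications a holomorphic chart with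
`Σⱼ (Θ y)ⱼ^{aⱼ} = φ(y)`, weights `aⱼ ≥ 2`: `a = (2, …, 2)` at a node, `a = (2, …, 2, 4)` at an `A₃` point). The ONLY analytic input
about the weights — the transversality of the chart spheres `Σⱼ|Θ y|ⱼ² = const` to the pencil members inside the shell
`s₀² ≤ Σⱼ|Θ y|ⱼ² ≤ r₂²`, `|φ| ≤ δ` — enters as the ABSTRACT hypothesis

  `hsub : ∀ y ∈ Θ.source, s₀² ≤ Σⱼ|Θ y|ⱼ² → Σⱼ|Θ y|ⱼ² ≤ r₂² → |φ y| ≤ δ → (φ, Σⱼ|Θ ·|ⱼ²) has onto real differential at y`,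

discharged by `Geometry/ComplexAnalytic/QuadricPencilShellSubmersion` (weights `2`),
`Geometry/ComplexAnalytic/SuspendedNodePencilShellSubmersion` (weights `(2, …, 2, p)`, prover-Bx B4b) or
`CyclicNodePencilShellSubmersion` (`(2, 2, p)`). The shell set `NodalPencil.shellSet Θ φ s₀ r₂ δ d i b'` and the affine shell
`NodalPencil.affineShell` are REUSED verbatim (they do not mention the weights).

* `surjective_mfderiv_regCoeff_prod_chartRadius_of_fderiv` — the manifold differential of `Q' ↦ (b(Q'), regChartExtend n d i B Q')`
  at `Q` is onto as soon as the Euclidean partial map `y' ↦ (φ y', Σⱼ|Θ y'|ⱼ²)` has onto differential at `y(Q)` and `B` agrees with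
  `v ↦ Σⱼ|Θ(v_y)|ⱼ²` near `Φᵢ(Q)`;
* `surjective_mfderiv_on_shellSet` — `(b, ρ̃)` is submersive along the shell set, `ρ̃ = regChartExtend n d i (ChartRadius.cutoff Θ R'' R' ∘ y)`;
* `exists_shell_tangent_lift` — **every `C^∞` coefficient field `W` lifts to a `C^∞` field `X` on `𝒴°(ℂ)` with `db(X) = W(b)`
  everywhere and `dρ̃(X) = 0` on the shell set** (`Motives/UniversalHypersurfaceRegularLocusLift`).

Everything is proved; no definitions, no named facts. Honest scope: local differential plumbing of the classical construction of the
geometric monodromy of a pencil near an isolated weighted-homogeneous singular point; nothing here says HC or any rung is proved.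

## References

* [ArnoldGuseinzadeVarchenko2012] V. I. Arnold, S. M. Gusein-Zade, A. N. Varchenko, Singularities of Differentiable Maps II (2012),
  Part I §1.1, §2.1 (the monodromy vector field is tangent to the boundary of the Milnor ball).
* [Milnor1968] J. Milnor, Singular Points of Complex Hypersurfaces (1968), §4–§5, Lemma 5.10; §9 (weighted homogeneous polynomials).
* [BrockerJanichIDT1982] T. Bröcker, K. Jänich, Introduction to Differential Topology (1982), (8.12).
-/

noncomputable section

open CategoryTheory AlgebraicGeometry MvPolynomial TopologicalSpace Set Topology Filter
open scoped Manifold ContDiff LinearAlgebra.Projectivization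
open Literature.AlgebraicGeometry.Motives Literature.AlgebraicGeometry.Motives.UniversalHypersurface
open Literature.AlgebraicGeometry.HodgeTheory.UniversalHypersurface Literature.Geometry.ComplexAnalytic
open Literature.NumberTheory.Transcendental

namespace Literature.AlgebraicGeometry.HodgeTheory

namespace WeightedPencil

variable {n : ℕ} (Θ : OpenPartialHomeomorph (Fin (n + 1) → ℂ) (Fin (n + 1) → ℂ)) (φ : (Fin (n + 1) → ℂ) → ℂ)
  (s₀ r₂ δ : ℝ) (d : ℕ) (i : Fin (n + 2)) (b' : {m : DegIndex n d // m ≠ regPowIndex n d i} → ℂ)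

/-! ### Joint submersivity of (coefficients, chart radius) from the Euclidean partial map -/

/-- **Joint submersivity of (coefficients, chart radius) from the submersivity of `(φ, Σⱼ|Θ ·|ⱼ²)`.** Let `φ(y')` be the solved
coefficient of `xᵢ^d` at the remaining coefficients `b'` minus a constant `c₀`, `B` a `C^∞` real function of the chart coordinates of
`𝒴°(ℂ)ᵢ` agreeing with `v ↦ Σⱼ|Θ(v_y)ⱼ|²` near `Φᵢ(Q)`, `Q ∈ 𝒴°(ℂ)ᵢ` with remaining coefficients `b'`. If the real differential at
`y(Q)` of `y' ↦ (φ y', Σⱼ|Θ y'|ⱼ²)` is onto, then so is the manifold differential at `Q` of `Q' ↦ (b(Q'), regChartExtend n d i B Q')`.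
[cite: Milnor1968, Lemma 5.10] [cite: BrockerJanichIDT1982, §5] -/
theorem surjective_mfderiv_regCoeff_prod_chartRadius_of_fderiv (hd : 0 < d) (c₀ : ℂ)
    (hφ : ∀ y, φ y = regChartCoeffVec n d i (Sum.elim b' y) (regPowIndex n d i) - c₀)
    (B : (ChartIdx n d i → ℂ) → ℝ) (hB : ContDiff ℝ ∞ B)
    {Q : ComplexPoints (regularTotal ℂ n d)} (hQ : Q ∈ regChartDom n d i)
    (hb' : ∀ m : {m : DegIndex n d // m ≠ regPowIndex n d i}, regChartFun n d i Q (Sum.inl m) = b' m)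
    (hsub : Function.Surjective
      (fderiv ℝ (fun y' : Fin (n + 1) → ℂ => ((φ y' : ℂ), (∑ j, ‖Θ y' j‖ ^ 2 : ℝ)))
        (fun j => regChartFun n d i Q (Sum.inr j))))
    (hBloc : B =ᶠ[𝓝 (regChartFun n d i Q)] fun v => ∑ j, ‖Θ (fun j => v (Sum.inr j)) j‖ ^ 2) :
    haveI := locallyOfFiniteType_regularTotal_hom ℂ n d hd
    haveI := smoothOfRelativeDimension_regularTotal_hom ℂ n d hd
    letI := ComplexPoints.chartedSpace (regularTotal ℂ n d) (n + Fintype.card (DegIndex n d))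
    Function.Surjective (mfderiv (𝓡 (2 * (n + Fintype.card (DegIndex n d)))) 𝓘(ℝ, (DegIndex n d → ℂ) × ℝ)
      (fun Q' => (regCoeff ℂ n d Q', regChartExtend n d i B Q')) Q) := by
  -- chart coordinates of `Q`: `v₀ = (b', y)`
  set y : Fin (n + 1) → ℂ := fun j => regChartFun n d i Q (Sum.inr j) with hydef
  have hv₀ : regChartFun n d i Q = Sum.elim b' y := by
    funext s
    rcases s with m | j
    · exact hb' m
    · rfl
  -- the solved coefficient as a function of `y'` at fixed `b'`
  set c : (Fin (n + 1) → ℂ) → ℂ := fun y' => regChartCoeffVec n d i (Sum.elim b' y') (regPowIndex n d i) with hcdef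
  -- Step 1: manifold ⇐ Euclidean in the chart
  refine surjective_mfderiv_pair_of_surjective_fderiv n d i hd B hB hQ ?_
  rw [hv₀]
  -- Step 2: Euclidean ⇐ partial map in `y`
  refine surjective_fderiv_coeffVec_prod_of_partial n d i B b' y ((hB.differentiable (by simp)).differentiableAt) ?_
  -- Step 3: the partial map is `(c, Σ|Θ|²)` near `y`
  have hcont : Continuous fun y' : Fin (n + 1) → ℂ => (Sum.elim b' y' : ChartIdx n d i → ℂ) := by
    refine continuous_pi fun s => ?_
    rcases s with m | j
    · exact continuous_const
    · exact continuous_apply j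
  have hBy : (fun y' : Fin (n + 1) → ℂ => B (Sum.elim b' y')) =ᶠ[𝓝 y] fun y' => ∑ j, ‖Θ y' j‖ ^ 2 := by
    have ht : Tendsto (fun y' : Fin (n + 1) → ℂ => (Sum.elim b' y' : ChartIdx n d i → ℂ)) (𝓝 y)
        (𝓝 (regChartFun n d i Q)) := by
      rw [hv₀]; exact hcont.continuousAt
    filter_upwards [ht.eventually hBloc] with y' hy'
    exact hy'
  have hpartial : (fun y' : Fin (n + 1) → ℂ =>
      (regChartCoeffVec n d i (Sum.elim b' y') (regPowIndex n d i), B (Sum.elim b' y'))) =ᶠ[𝓝 y]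
      fun y' => ((c y' : ℂ), (∑ j, ‖Θ y' j‖ ^ 2 : ℝ)) := by
    filter_upwards [hBy] with y' hy'
    rw [Prod.mk.injEq]
    exact ⟨rfl, hy'⟩
  rw [hpartial.fderiv_eq]
  -- Step 4: `(c, Σ|Θ|²) = (φ, Σ|Θ|²) + (c₀, 0)`
  have heq : (fun y' : Fin (n + 1) → ℂ => ((c y' : ℂ), (∑ j, ‖Θ y' j‖ ^ 2 : ℝ))) =
      fun y' => (fun y' : Fin (n + 1) → ℂ => ((φ y' : ℂ), (∑ j, ‖Θ y' j‖ ^ 2 : ℝ))) y' + ((c₀ : ℂ), (0 : ℝ)) := by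
    funext y'
    simp [hcdef, hφ y']
  rw [heq, fderiv_add_const]
  exact hsub

/-! ### The submersion along the shell set and the tangent lift -/

/-- **`(b, ρ̃)` is submersive along the shell set** `NodalPencil.shellSet Θ φ s₀ r₂ δ d i b'`, for
`ρ̃ = regChartExtend n d i (ChartRadius.cutoff Θ R'' R' ∘ y)`: `Θ` a `C^∞` chart with `{Σ|z|² ≤ R'} ⊆ Θ.target`, `r₂² < R'' < R'`,
`φ(y)` the solved coefficient of `xᵢ^d` at the remaining coefficients `b'` minus `c₀`, and the SHELL SUBMERSION hypothesis `hsub`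
(onto differential of `(φ, Σⱼ|Θ ·|ⱼ²)` at the points of the source with `s₀² ≤ Σⱼ|Θ y|ⱼ² ≤ r₂²`, `|φ y| ≤ δ`).
[cite: ArnoldGuseinzadeVarchenko2012, Part I §2.1] [cite: Milnor1968, Lemma 5.10] -/
theorem surjective_mfderiv_on_shellSet (hd : 0 < d) (hΘ : ContDiffOn ℝ ∞ Θ Θ.source) (c₀ : ℂ)
    (hφ : ∀ y, φ y = regChartCoeffVec n d i (Sum.elim b' y) (regPowIndex n d i) - c₀)
    {R'' R' : ℝ} (hR'' : r₂ ^ 2 < R'') (hR : R'' < R')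
    (hR' : {z : Fin (n + 1) → ℂ | ∑ j, ‖z j‖ ^ 2 ≤ R'} ⊆ Θ.target)
    (hsub : ∀ y ∈ Θ.source, s₀ ^ 2 ≤ ∑ j, ‖Θ y j‖ ^ 2 → ∑ j, ‖Θ y j‖ ^ 2 ≤ r₂ ^ 2 → ‖φ y‖ ≤ δ →
      Function.Surjective (fderiv ℝ (fun y' : Fin (n + 1) → ℂ => ((φ y' : ℂ), (∑ j, ‖Θ y' j‖ ^ 2 : ℝ))) y))
    {Q : ComplexPoints (regularTotal ℂ n d)} (hQ : Q ∈ NodalPencil.shellSet Θ φ s₀ r₂ δ d i b') :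
    haveI := locallyOfFiniteType_regularTotal_hom ℂ n d hd
    haveI := smoothOfRelativeDimension_regularTotal_hom ℂ n d hd
    letI := ComplexPoints.chartedSpace (regularTotal ℂ n d) (n + Fintype.card (DegIndex n d))
    Function.Surjective (mfderiv (𝓡 (2 * (n + Fintype.card (DegIndex n d)))) 𝓘(ℝ, (DegIndex n d → ℂ) × ℝ)
      (fun Q' => (regCoeff ℂ n d Q',
        regChartExtend n d i (fun v => ChartRadius.cutoff Θ R'' R' (fun j => v (Sum.inr j))) Q')) Q) := by
  obtain ⟨hdom, hyC, hb⟩ := NodalPencil.mem_shellSet_coords Θ φ s₀ r₂ δ d i b' hQ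
  obtain ⟨hys, hlow, hup, hφy⟩ := NodalPencil.mem_affineShell Θ φ s₀ r₂ δ hyC
  have hlin : ContDiff ℝ ∞ (fun v : ChartIdx n d i → ℂ => (fun j : Fin (n + 1) => v (Sum.inr j))) :=
    contDiff_pi.2 fun j => contDiff_apply ℝ ℂ (Sum.inr j : ChartIdx n d i)
  have hBcont : ContDiff ℝ ∞ (fun v : ChartIdx n d i → ℂ => ChartRadius.cutoff Θ R'' R' (fun j => v (Sum.inr j))) :=
    (ChartRadius.contDiff_cutoff Θ R'' R' hΘ hR hR').comp hlin
  have hBloc : (fun v : ChartIdx n d i → ℂ => ChartRadius.cutoff Θ R'' R' (fun j => v (Sum.inr j))) =ᶠ[𝓝 (regChartFun n d i Q)]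
      fun v => ∑ j, ‖Θ (fun j => v (Sum.inr j)) j‖ ^ 2 := by
    have hev := ChartRadius.cutoff_eventuallyEq Θ R'' R' hR hys (lt_of_le_of_lt hup hR'')
    have ht : Tendsto (fun v : ChartIdx n d i → ℂ => (fun j : Fin (n + 1) => v (Sum.inr j))) (𝓝 (regChartFun n d i Q))
        (𝓝 (fun j => regChartFun n d i Q (Sum.inr j))) := hlin.continuous.continuousAt
    exact hev.comp_tendsto ht
  exact surjective_mfderiv_regCoeff_prod_chartRadius_of_fderiv Θ φ d i b' hd c₀ hφ _ hBcont hdom hb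
    (hsub _ hys hlow hup hφy) hBloc

/-- **The lifted field tangent to the chart shells.** Under the hypotheses of `surjective_mfderiv_on_shellSet` (and `φ` continuous),
for every `C^∞` vector field `W` of the coefficient space there is a `C^∞` vector field `X` on `𝒴°(ℂ)` with `db(X) = W(b)` everywhere
and `dρ̃(X) = 0` on the shell set `NodalPencil.shellSet Θ φ s₀ r₂ δ d i b'`, `ρ̃ = regChartExtend n d i (ChartRadius.cutoff Θ R'' R' ∘ y)`.
[cite: ArnoldGuseinzadeVarchenko2012, Part I §2.1] [cite: BrockerJanichIDT1982, (8.12)] -/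
theorem exists_shell_tangent_lift (hd : 0 < d) (hφc : Continuous φ) (hΘ : ContDiffOn ℝ ∞ Θ Θ.source) (c₀ : ℂ)
    (hφ : ∀ y, φ y = regChartCoeffVec n d i (Sum.elim b' y) (regPowIndex n d i) - c₀)
    {R'' R' : ℝ} (hR'' : r₂ ^ 2 < R'') (hR : R'' < R')
    (hR' : {z : Fin (n + 1) → ℂ | ∑ j, ‖z j‖ ^ 2 ≤ R'} ⊆ Θ.target)
    (hsub : ∀ y ∈ Θ.source, s₀ ^ 2 ≤ ∑ j, ‖Θ y j‖ ^ 2 → ∑ j, ‖Θ y j‖ ^ 2 ≤ r₂ ^ 2 → ‖φ y‖ ≤ δ →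
      Function.Surjective (fderiv ℝ (fun y' : Fin (n + 1) → ℂ => ((φ y' : ℂ), (∑ j, ‖Θ y' j‖ ^ 2 : ℝ))) y))
    {W : (DegIndex n d → ℂ) → (DegIndex n d → ℂ)} (hW : ContDiff ℝ ∞ W) :
    haveI := locallyOfFiniteType_regularTotal_hom ℂ n d hd
    haveI := smoothOfRelativeDimension_regularTotal_hom ℂ n d hd
    letI := ComplexPoints.chartedSpace (regularTotal ℂ n d) (n + Fintype.card (DegIndex n d))
    haveI := ComplexPoints.isManifold_real (regularTotal ℂ n d) (n + Fintype.card (DegIndex n d))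
    ∃ X : Π Q : ComplexPoints (regularTotal ℂ n d), TangentSpace (𝓡 (2 * (n + Fintype.card (DegIndex n d)))) Q,
      ContMDiff (𝓡 (2 * (n + Fintype.card (DegIndex n d)))) (𝓡 (2 * (n + Fintype.card (DegIndex n d)))).tangent ∞
        (fun Q => (⟨Q, X Q⟩ : TangentBundle (𝓡 (2 * (n + Fintype.card (DegIndex n d)))) (ComplexPoints (regularTotal ℂ n d)))) ∧
      (∀ Q, mfderiv (𝓡 (2 * (n + Fintype.card (DegIndex n d)))) 𝓘(ℝ, DegIndex n d → ℂ) (fun Q' => regCoeff ℂ n d Q') Q (X Q) =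
        W (regCoeff ℂ n d Q)) ∧
      ∀ Q ∈ NodalPencil.shellSet Θ φ s₀ r₂ δ d i b',
        mfderiv (𝓡 (2 * (n + Fintype.card (DegIndex n d)))) 𝓘(ℝ, ℝ)
          (regChartExtend n d i (fun v => ChartRadius.cutoff Θ R'' R' (fun j => v (Sum.inr j)))) Q (X Q) = 0 := by
  have hlin : ContDiff ℝ ∞ (fun v : ChartIdx n d i → ℂ => (fun j : Fin (n + 1) => v (Sum.inr j))) :=
    contDiff_pi.2 fun j => contDiff_apply ℝ ℂ (Sum.inr j : ChartIdx n d i)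
  have hBcont : ContDiff ℝ ∞ (fun v : ChartIdx n d i → ℂ => ChartRadius.cutoff Θ R'' R' (fun j => v (Sum.inr j))) :=
    (ChartRadius.contDiff_cutoff Θ R'' R' hΘ hR hR').comp hlin
  obtain ⟨R, hRb⟩ := ChartRadius.exists_bound_cutoff Θ R'' R' hR hR'
  have hBR : ∀ v : ChartIdx n d i → ℂ, R < ‖fun j => v (Sum.inr j)‖ →
      ChartRadius.cutoff Θ R'' R' (fun j => v (Sum.inr j)) = 0 := fun v hv => hRb _ hv
  have hK := NodalPencil.isClosed_shellSet Θ φ s₀ r₂ δ d i b' hd hφc hR' (hR''.le.trans hR.le)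
  exact exists_contMDiff_lift_tangent_regChartExtend n d i hd hW _ hBcont hBR hK
    (fun Q hQ => surjective_mfderiv_on_shellSet Θ φ s₀ r₂ δ d i b' hd hΘ c₀ hφ hR'' hR hR' hsub hQ)

end WeightedPencil

end Literature.AlgebraicGeometry.HodgeTheory

end
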